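import Summits.Ventures.PercRepro.C041BlockMapReachBound
import Summits.Ventures.PercRepro.C041MultiExitTwo
import Summits.Ventures.PercRepro.C041BlockMapCycle

/-!
# ROW C-041 — THE FOUR-VERTEX CORES: the block maps of `K₄` and of the two diamonds with two exits, in closed
form (p6, gen 36; the next open cores of the block-map programme after the triangle, their maps decided)

Setting of `C041BlockMapReachBound` (the statuses of a finite host are paths of fewer steps than vertices —
decided) and `C041MultiExitTwo` (`blockMap_ex2`: the two-exit block map as the sum over the colourings of
`contrib` by the five statuses).  THE CORES: a host on four vertices with the anchor `0`, the exits `1` (`u`)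
and `2` (`u′`) and an inner vertex `3` is reducible by the surgeries of the row unless it is simple,
2-connected and the inner vertex has degree `3`: these are `K₄` (`k4`, six edges), the diamond `K₄ − uu′` (`d1`:
the inner vertex adjacent to all three terminals, the exits not adjacent) and the diamond `K₄ − au` (`d2`: the
anchor not adjacent to the exit `u`) — the diamond `K₄ − a3` (the square with the chord `uu′`, inner vertex of
degree `2`) is the triangle with its exit edge doubled and one copy subdivided (`dup` + `path`), hence reduces
to the triangle.  THEIR BLOCK MAPS (`blockMap_k4`, `blockMap_d1`, `blockMap_d2`): integer combinations of the
pattern atoms — with `X ∈ {w, θ_B w}`, `Y ∈ {w′, θ_B w′}` by the reached statuses: `X·Y` (both merged),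
`X·θ_R Y` / `θ_R X·Y` (one merged), `θ_R (X·Y)` (both separated in one blue sub-zone), `θ_R X·θ_R Y` (apart) —
e.g. `Θ_{K₄}(w, w′) = 10·θ_B w·θ_B w′ + 6·θ_B w·w′ + 6·w·θ_B w′ + 6·θ_R(w·w′) + 4·θ_R w·θ_R w′ + 6·θ_R w·w′ +
6·w·θ_R w′ + 20·w·w′` (64 colourings).  Proof: the statuses of every colouring are Boolean reachabilities in
`≤ 3` steps (`connB`, `adjB`; `statuses_k4` … by `decide` over the `2⁶` / `2⁵` colourings), the sum over the
colourings is a sum over tuples (`fin6Equiv`, `fin5Equiv`), every colouring term evaluates (`decide`), and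
`ring` collects the atoms.  The cone form of these maps on cone inputs is the next conjecture of the row after
the triangle (CONJECTURE (BLOCK MAP) for `k4`, `d1`, `d2`); the twin fourcores.py checks the three closed forms
against the block map computed from its definition (40 / 40 random rational inputs each).
-/

namespace PercRepro

namespace ZoneZ

namespace MultiExit

open ZoneData Pendant Finset TwoExit TreeClosure

/-! ## Boolean reachability on four vertices -/

/-- Boolean reachability in at most `k` steps of a Boolean adjacency on four vertices. -/
def connB (adj : Fin 4 → Fin 4 → Bool) : ℕ → Fin 4 → Fin 4 → Bool
  | 0, s, v => decide (s = v)
  | k + 1, s, v => connB adj k s v || (adj s 0 && connB adj k 0 v) || (adj s 1 && connB adj k 1 v) ||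
      (adj s 2 && connB adj k 2 v) || (adj s 3 && connB adj k 3 v)

/-- The colour-`c` adjacency of a host on four vertices, as a Boolean function. -/
def adjB {E U₁ U₂ : Type} [Fintype E] (Z : ZoneData (Fin 4) E U₁ U₂) (c : Bool) (ω : E → Bool)
    (x y : Fin 4) : Bool :=
  decide (∃ e, (Z.fst e = x ∧ Z.snd e = y ∨ Z.fst e = y ∧ Z.snd e = x) ∧ ω e = c)

/-- A colouring of six edges is the vector of its values. -/
theorem fin6_eta (ω : Fin 6 → Bool) : ω = ![ω 0, ω 1, ω 2, ω 3, ω 4, ω 5] := by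
  funext i
  fin_cases i <;> rfl

/-- A colouring of five edges is the vector of its values. -/
theorem fin5_eta (ω : Fin 5 → Bool) : ω = ![ω 0, ω 1, ω 2, ω 3, ω 4] := by
  funext i
  fin_cases i <;> rfl

/-- The colourings of six edges as 6-tuples. -/
def fin6Equiv : (Fin 6 → Bool) ≃ Bool × Bool × Bool × Bool × Bool × Bool where
  toFun ω := (ω 0, ω 1, ω 2, ω 3, ω 4, ω 5)
  invFun p := ![p.1, p.2.1, p.2.2.1, p.2.2.2.1, p.2.2.2.2.1, p.2.2.2.2.2]
  left_inv ω := (fin6_eta ω).symm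
  right_inv p := by
    obtain ⟨b₀, b₁, b₂, b₃, b₄, b₅⟩ := p
    rfl

/-- The inverse of the 6-tuple bijection. -/
theorem fin6Equiv_symm_apply (b₀ b₁ b₂ b₃ b₄ b₅ : Bool) :
    fin6Equiv.symm (b₀, b₁, b₂, b₃, b₄, b₅) = ![b₀, b₁, b₂, b₃, b₄, b₅] := rfl

/-- The colourings of five edges as 5-tuples. -/
def fin5Equiv : (Fin 5 → Bool) ≃ Bool × Bool × Bool × Bool × Bool where
  toFun ω := (ω 0, ω 1, ω 2, ω 3, ω 4)
  invFun p := ![p.1, p.2.1, p.2.2.1, p.2.2.2.1, p.2.2.2.2]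
  left_inv ω := (fin5_eta ω).symm
  right_inv p := by
    obtain ⟨b₀, b₁, b₂, b₃, b₄⟩ := p
    rfl

/-- The inverse of the 5-tuple bijection. -/
theorem fin5Equiv_symm_apply (b₀ b₁ b₂ b₃ b₄ : Bool) :
    fin5Equiv.symm (b₀, b₁, b₂, b₃, b₄) = ![b₀, b₁, b₂, b₃, b₄] := rfl

/-! ## The three cores -/

/-- `K₄` on the anchor `0`, the exits `1`, `2` and the inner vertex `3`: the edges `0 → 1`, `1 → 2`, `2 → 0`,
`0 → 3`, `1 → 3`, `2 → 3`. -/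
def k4 : ZoneData (Fin 4) (Fin 6) Empty Empty where
  fst := ![0, 1, 2, 0, 1, 2]
  snd := ![1, 2, 0, 3, 3, 3]
  at₁ := Empty.elim
  at₂ := Empty.elim

/-- The diamond `K₄ − uu′`: the inner vertex `3` adjacent to the three terminals, the anchor adjacent to both
exits, the exits not adjacent — the edges `0 → 1`, `2 → 0`, `0 → 3`, `1 → 3`, `2 → 3`. -/
def d1 : ZoneData (Fin 4) (Fin 5) Empty Empty where
  fst := ![0, 2, 0, 1, 2]
  snd := ![1, 0, 3, 3, 3]
  at₁ := Empty.elim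
  at₂ := Empty.elim

/-- The diamond `K₄ − au`: the anchor not adjacent to the exit `1` — the edges `1 → 2`, `2 → 0`, `0 → 3`,
`1 → 3`, `2 → 3`. -/
def d2 : ZoneData (Fin 4) (Fin 5) Empty Empty where
  fst := ![1, 2, 0, 1, 2]
  snd := ![2, 0, 3, 3, 3]
  at₁ := Empty.elim
  at₂ := Empty.elim

/-! ## The statuses, decided -/

/-- The statuses of the exits of `k4` for every colouring, as Boolean reachability in `≤ 3` steps. -/
theorem statuses_k4 (b : Fin 6 → Bool) :
    (k4.Mg 0 1 b ↔ connB (adjB k4 false b) 3 0 1 = true) ∧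
    (k4.Mg 0 2 b ↔ connB (adjB k4 false b) 3 0 2 = true) ∧
    (k4.Mg 1 2 b ↔ connB (adjB k4 false b) 3 1 2 = true) ∧
    (k4.Rd 0 1 b ↔ connB (adjB k4 true b) 3 0 1 = true) ∧
    (k4.Rd 0 2 b ↔ connB (adjB k4 true b) 3 0 2 = true) := by
  simp only [Mg_iff_conn k4 (k := 3) (by simp), Rd_iff_conn k4 (k := 3) (by simp)]
  rw [fin6_eta b]
  generalize b 0 = b₀
  generalize b 1 = b₁
  generalize b 2 = b₂
  generalize b 3 = b₃
  generalize b 4 = b₄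
  generalize b 5 = b₅
  simp only [Conn]
  unfold cAdj ZoneData.Joins
  refine ⟨?_, ?_, ?_, ?_, ?_⟩ <;>
    (cases b₀ <;> cases b₁ <;> cases b₂ <;> cases b₃ <;> cases b₄ <;> cases b₅ <;> decide)

/-- The statuses of the exits of `d1` for every colouring, as Boolean reachability in `≤ 3` steps. -/
theorem statuses_d1 (b : Fin 5 → Bool) :
    (d1.Mg 0 1 b ↔ connB (adjB d1 false b) 3 0 1 = true) ∧
    (d1.Mg 0 2 b ↔ connB (adjB d1 false b) 3 0 2 = true) ∧
    (d1.Mg 1 2 b ↔ connB (adjB d1 false b) 3 1 2 = true) ∧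
    (d1.Rd 0 1 b ↔ connB (adjB d1 true b) 3 0 1 = true) ∧
    (d1.Rd 0 2 b ↔ connB (adjB d1 true b) 3 0 2 = true) := by
  simp only [Mg_iff_conn d1 (k := 3) (by simp), Rd_iff_conn d1 (k := 3) (by simp)]
  rw [fin5_eta b]
  generalize b 0 = b₀
  generalize b 1 = b₁
  generalize b 2 = b₂
  generalize b 3 = b₃
  generalize b 4 = b₄
  simp only [Conn]
  unfold cAdj ZoneData.Joins
  refine ⟨?_, ?_, ?_, ?_, ?_⟩ <;>
    (cases b₀ <;> cases b₁ <;> cases b₂ <;> cases b₃ <;> cases b₄ <;> decide)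

/-- The statuses of the exits of `d2` for every colouring, as Boolean reachability in `≤ 3` steps. -/
theorem statuses_d2 (b : Fin 5 → Bool) :
    (d2.Mg 0 1 b ↔ connB (adjB d2 false b) 3 0 1 = true) ∧
    (d2.Mg 0 2 b ↔ connB (adjB d2 false b) 3 0 2 = true) ∧
    (d2.Mg 1 2 b ↔ connB (adjB d2 false b) 3 1 2 = true) ∧
    (d2.Rd 0 1 b ↔ connB (adjB d2 true b) 3 0 1 = true) ∧
    (d2.Rd 0 2 b ↔ connB (adjB d2 true b) 3 0 2 = true) := by
  simp only [Mg_iff_conn d2 (k := 3) (by simp), Rd_iff_conn d2 (k := 3) (by simp)]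
  rw [fin5_eta b]
  generalize b 0 = b₀
  generalize b 1 = b₁
  generalize b 2 = b₂
  generalize b 3 = b₃
  generalize b 4 = b₄
  simp only [Conn]
  unfold cAdj ZoneData.Joins
  refine ⟨?_, ?_, ?_, ?_, ?_⟩ <;>
    (cases b₀ <;> cases b₁ <;> cases b₂ <;> cases b₃ <;> cases b₄ <;> decide)

/-! ## THE MAPS -/

/-- **THE `K₄` MAP: the block map of `K₄` with two exits, in closed form (64 colourings, 8 atoms).** -/
theorem blockMap_k4 (w w' : Vec6) :
    blockMap k4 (ex2 1 2) 0 (fun b => if b then w' else w) =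
      (10 : Vec6) * (thB w * thB w') + (6 : Vec6) * (thB w * w') + (6 : Vec6) * thR (w * w') +
        (4 : Vec6) * (thR w * thR w') + (6 : Vec6) * (thR w * w') + (6 : Vec6) * (w * thB w') +
        (6 : Vec6) * (w * thR w') + (20 : Vec6) * (w * w') := by
  rw [blockMap_ex2, Fintype.sum_equiv fin6Equiv _ (fun p => contrib w w'
      (k4.Mg 0 1 (fin6Equiv.symm p)) (k4.Rd 0 1 (fin6Equiv.symm p)) (k4.Mg 0 2 (fin6Equiv.symm p))
      (k4.Rd 0 2 (fin6Equiv.symm p)) (k4.Mg 1 2 (fin6Equiv.symm p))) (fun ω => by rw [Equiv.symm_apply_apply]; rfl)]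
  simp only [Fintype.sum_prod_type, Fintype.sum_bool, fin6Equiv_symm_apply, statuses_k4]
  simp (config := { decide := true }) only [contrib, exitOf, if_true, if_false]
  ring

/-- **THE DIAMOND MAP `K₄ − uu′`: in closed form (32 colourings, 10 atoms).** -/
theorem blockMap_d1 (w w' : Vec6) :
    blockMap d1 (ex2 1 2) 0 (fun b => if b then w' else w) =
      (5 : Vec6) * (thB w * thB w') + (2 : Vec6) * (thB w * thR w') + (4 : Vec6) * (thB w * w') +
        thR (w * w') + (2 : Vec6) * (thR w * thB w') + (4 : Vec6) * (thR w * thR w') +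
        (4 : Vec6) * (thR w * w') + (4 : Vec6) * (w * thB w') + (4 : Vec6) * (w * thR w') +
        (2 : Vec6) * (w * w') := by
  rw [blockMap_ex2, Fintype.sum_equiv fin5Equiv _ (fun p => contrib w w'
      (d1.Mg 0 1 (fin5Equiv.symm p)) (d1.Rd 0 1 (fin5Equiv.symm p)) (d1.Mg 0 2 (fin5Equiv.symm p))
      (d1.Rd 0 2 (fin5Equiv.symm p)) (d1.Mg 1 2 (fin5Equiv.symm p))) (fun ω => by rw [Equiv.symm_apply_apply]; rfl)]
  simp only [Fintype.sum_prod_type, Fintype.sum_bool, fin5Equiv_symm_apply, statuses_d1]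
  simp (config := { decide := true }) only [contrib, exitOf, if_true, if_false]
  ring

/-- **THE DIAMOND MAP `K₄ − au`: in closed form (32 colourings, 10 atoms).** -/
theorem blockMap_d2 (w w' : Vec6) :
    blockMap d2 (ex2 1 2) 0 (fun b => if b then w' else w) =
      (8 : Vec6) * (thB w * thB w') + (4 : Vec6) * (thB w * w') + (2 : Vec6) * thR (thB w * w') +
        (2 : Vec6) * (thR (thB w) * thB w') + (4 : Vec6) * thR (w * w') + (4 : Vec6) * (thR w * thR w') +
        (4 : Vec6) * (thR w * w') + w * thB w' + w * thR w' + (2 : Vec6) * (w * w') := by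
  rw [blockMap_ex2, Fintype.sum_equiv fin5Equiv _ (fun p => contrib w w'
      (d2.Mg 0 1 (fin5Equiv.symm p)) (d2.Rd 0 1 (fin5Equiv.symm p)) (d2.Mg 0 2 (fin5Equiv.symm p))
      (d2.Rd 0 2 (fin5Equiv.symm p)) (d2.Mg 1 2 (fin5Equiv.symm p))) (fun ω => by rw [Equiv.symm_apply_apply]; rfl)]
  simp only [Fintype.sum_prod_type, Fintype.sum_bool, fin5Equiv_symm_apply, statuses_d2]
  simp (config := { decide := true }) only [contrib, exitOf, if_true, if_false]
  ring

/-! ## The fourth diamond reduces to the triangle -/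

/-- The loopified copy of a doubled edge is a loop at its first end. -/
theorem loopify_dup_none {V₁ E₁ U₁ U₂ : Type} (Z : ZoneData V₁ E₁ U₁ U₂) [DecidableEq E₁] (e₀ : E₁) :
    loopify (dup Z e₀) none = addLoop Z (Z.fst e₀) := by
  refine ZoneData.ext' rfl ?_ rfl rfl
  funext e
  rcases e with _ | e
  · exact loopify_snd_self _ _
  · exact loopify_snd_of_ne _ (Option.some_ne_none e)

/-- The exits of the triangle contracted along the edge between them are coincident. -/
theorem triExit_contract : (fun k => redC (tri.fst 1) (tri.snd 1) (triExit k)) = fun _ => (1 : Fin 3) := by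
  funext k
  rcases k with ⟨⟩ | ⟨⟩ <;> rfl

/-- **The diamond `K₄ − a3` reduces to the triangle**: the triangle with the edge between its exits doubled and
one copy replaced by a path with `n` internal vertices (for `n = 1`: the square `a – u – 3 – u′ – a` with the
chord `uu′`) is a cone host as soon as the triangle is — `Built.dup` with the contraction (coincident exits,
THEOREM (COINCIDENT EXITS)) and `Built.path` with the loopified copy (a loop at `u`, `Built.addLoop`). -/
theorem coneHost_triDupPath_of_tri (h : ConeHost tri triExit 0) (n : ℕ) :
    ConeHost (pathHost (dup tri 1) none n) (fun k => Sum.inl (triExit k)) (Sum.inl 0) := by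
  refine coneHost_of_built (Built.path _ none n triExit 0 ?_ ?_)
  · refine Built.dup tri 1 triExit 0 (Built.core _ _ _ h) ?_
    rw [triExit_contract]
    exact Built.core _ _ _ (coneHost_const _ _ _)
  · rw [loopify_dup_none]
    exact Built.addLoop tri _ triExit 0 (Built.core _ _ _ h)

end MultiExit

end ZoneZ

end PercRepro
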